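import Summits.Ventures.PackingBounds.Configurations.CliqueFrame
import Summits.Ventures.PackingBounds.Configurations.Dim7Card56Frame
import Summits.Ventures.PackingBounds.Configurations.Dim7Card56EnergyRigidity

/-!
# Uniqueness of the 56-point sharp configuration on `S⁶` (the `(7, 56, 1/3)` code, `E₇` / 28 equiangular lines)

Framing: lottery ticket; floor = certified bounds/negative ranges. Venture `PackingBounds` (cell
`pub-packcert`, seat `pub-packcert-energy`) — Cohn–Kumar Table 1, row `(7, 56)`, uniqueness column, step 3 of 3
(after `Dim7Card56Design`, `Dim7Card56Frame`).

**Theorem** (`isometric`). Any two `56`-point codes in `ℝ⁷` with pairwise inner products `≤ 1/3` are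
isometric (Bannai–Sloane 1981; Conway–Sloane Ch. 14 Thm 11–12, there via the uniqueness of the `E₈` kissing
configuration); with `Dim7Card56EnergyRigidity` every `56`-point ground state of `(1+t)^k` (`k ≥ 6`) is
isometric to every such code (`isometric_of_ckPow_energy_eq`). The proof here is the classification-free
"clique frame" argument of `Dim5Card16Unique` / `Dim6Card27Unique`:

1. complementary slackness for `(t + 1)(t + 1/3)²(t - 1/3)`: inner products in `{1/3, -1/3, -1}`, moments of
   orders `1…4` vanish, hence the design identities of strengths `1, 2, 3` (`DesignIdentities`):
   `Σ_w ⟪u,w⟫ = 0`, `Σ_w ⟪u,w⟫⟪v,w⟫ = 8⟪u,v⟫`, `Σ_w ⟪u,w⟫⟪v,w⟫⟪z,w⟫ = 0`;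
2. for `x ∈ C`, a point `x₀` at `1/3` from `x`, and a point `y₀` at `1/3` from both (there are `16`), the set `K` of
   points at `1/3` from `x, x₀` and `-1/3` from `y₀` has five elements (cubic functional
   `(1+3⟪x,w⟫)(1+3⟪x₀,w⟫)(1-3⟪y₀,w⟫)/8`) pairwise at `1/3`: `{x, x₀} ∪ K` is a `1/3`-frame, a basis of `ℝ⁷`;
3. the profile of every `z ∈ C` against the frame is `-1` somewhere (then `z = -a_k`) or two-valued with
   `#{j : ⟪z,aⱼ⟫ = -1/3} ∈ {2, 5}` (norm identity): `C` is the image of a fixed `56`-member family;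
4. `CliqueFrame.isometric_of_frames`.

## References
* E. Bannai, N. J. A. Sloane, Canad. J. Math. 33 (1981) 437–449 (= Conway–Sloane, *SPLAG*, Ch. 14 Thm 11–12). [`ConwaySloane1999`]
* H. Cohn, A. Kumar, J. Amer. Math. Soc. 20 (2007) 99–148, Table 1 and Appendix A. [`CohnKumar2006`]
-/

noncomputable section

namespace Summit.Ventures.PackingBounds.Config.Dim7Card56Unique

open Finset Module Literature.Analysis.SpecialFunctions Literature.Geometry.DiscreteGeometry CliqueFrame

/-! ### Index data of the family and the profile of a point -/

/-- Index set of the `56`-point family: frame vectors (`{k}`, `0`), their antipodes (`univ \ {k}`, `1`),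
`21` points `Σ_{j ∈ T} aⱼ - σ/3` (`|T| = 2`) and `21` points `Σ_{j ∈ T} aⱼ - (2/3)σ` (`|T| = 5`). -/
abbrev Idx : Type :=
  Fin 7 ⊕ Fin 7 ⊕ {T : Finset (Fin 7) // T.card = 2} ⊕ {T : Finset (Fin 7) // T.card = 5}

/-- The subset of the frame entering the member of the family. -/
def setOf : Idx → Finset (Fin 7)
  | Sum.inl k => {k}
  | Sum.inr (Sum.inl k) => univ.erase k
  | Sum.inr (Sum.inr (Sum.inl T)) => T.1
  | Sum.inr (Sum.inr (Sum.inr T)) => T.1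

/-- The coefficient of `σ = Σ aⱼ` subtracted in the member of the family. -/
def coefOf : Idx → ℝ
  | Sum.inl _ => 0
  | Sum.inr (Sum.inl _) => 1
  | Sum.inr (Sum.inr (Sum.inl _)) => 1 / 3
  | Sum.inr (Sum.inr (Sum.inr _)) => 2 / 3

/-- The index set has `56 = 7 + 7 + 21 + 21` elements. -/
theorem card_Idx : Fintype.card Idx = 56 := by
  simp only [Idx, Fintype.card_sum, Fintype.card_fin]
  rfl

/-- `fam a T c` as a single sum of multiples of the frame. -/
private theorem fam_eq_sum {a : Fin 7 → EuclideanSpace ℝ (Fin 7)} (T : Finset (Fin 7)) (c : ℝ) :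
    fam a T c = ∑ j, ((if j ∈ T then (1 : ℝ) else 0) - c) • a j := by
  classical
  simp only [fam, sub_smul, Finset.sum_sub_distrib, ite_smul, one_smul, zero_smul, Finset.sum_ite_mem,
    Finset.univ_inter, Finset.smul_sum]

section profile

variable {C : Finset (EuclideanSpace ℝ (Fin 7))} (h1 : ∀ x ∈ C, ‖x‖ = 1)
  (h2 : ∀ x ∈ C, ∀ y ∈ C, x ≠ y → inner ℝ x y ≤ 1 / 3) (hN : C.card = 56)
  {a : Fin 7 → EuclideanSpace ℝ (Fin 7)} (ha : ∀ i, a i ∈ C)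
  (hG : ∀ i j, inner ℝ (a i) (a j) = if i = j then 1 else 1 / 3)
include h1 h2 hN ha hG

/-- **Every point of the code is a member of the fixed family over the frame.** -/
theorem exists_index {z : EuclideanSpace ℝ (Fin 7)} (hz : z ∈ C) :
    ∃ x : Idx, z = fam a (setOf x) (coefOf x) := by
  classical
  by_cases hza : ∃ k, z = a k
  · obtain ⟨k, rfl⟩ := hza
    exact ⟨Sum.inl k, (fam_singleton_zero a k).symm⟩
  push Not at hza
  by_cases hzn : ∃ k, inner ℝ z (a k) = -1
  · -- an antipode of a frame vector
    obtain ⟨k, hk⟩ := hzn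
    have hz : a k = -z := CrossPolytopeUnique.eq_neg_of_inner_eq_neg_one (h1 z hz) (h1 _ (ha k)) hk
    refine ⟨Sum.inr (Sum.inl k), ?_⟩
    rw [setOf, coefOf, fam, Finset.sum_erase_eq_sub (mem_univ k), one_smul, hz]
    abel
  push Not at hzn
  have hb : ∀ k, inner ℝ z (a k) = 1 / 3 ∨ inner ℝ z (a k) = -1 / 3 := by
    intro k
    rcases inner_of_card_eq_56 h1 h2 hN hz (ha k) (hza k) with h | h | h
    · exact Or.inl h
    · exact Or.inr h
    · exact absurd h (hzn k)
  have hcard : Fintype.card (Fin 7) = finrank ℝ (EuclideanSpace ℝ (Fin 7)) := by simp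
  have hrepr := repr_formula hG (by norm_num) (by norm_num) hcard z
  have hnorm := norm_identity hG (by norm_num) (by norm_num) hcard z
  have hs1 := sum_comp_two_values (fun k => inner ℝ z (a k)) hb (fun t => t)
  have hs2 := sum_comp_two_values (fun k => inner ℝ z (a k)) hb (fun t => t ^ 2)
  set S := univ.filter fun k => inner ℝ z (a k) = -1 / 3 with hS
  simp only [Fintype.card_fin, Nat.cast_ofNat] at hrepr hnorm hs1 hs2
  rw [h1 z hz, hs1, hs2] at hnorm
  have hs : S.card = 2 ∨ S.card = 5 := by
    have hq : ((S.card : ℝ) - 2) * ((S.card : ℝ) - 5) = 0 := by nlinarith [hnorm]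
    rcases mul_eq_zero.mp hq with h | h
    · left; exact_mod_cast (by linarith : (S.card : ℝ) = 2)
    · right; exact_mod_cast (by linarith : (S.card : ℝ) = 5)
  have hcoef : ∀ j, (inner ℝ z (a j) - 1 / 3 * (∑ i, inner ℝ z (a i)) / (1 + (7 - 1) * (1 / 3))) / (1 - 1 / 3)
      = (if j ∈ univ \ S then (1 : ℝ) else 0) - (8 - (S.card : ℝ)) / 9 := by
    intro j
    rw [hs1]
    by_cases hj : inner ℝ z (a j) = -1 / 3
    · have hjS : j ∈ S := mem_filter.mpr ⟨mem_univ j, hj⟩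
      rw [if_neg (fun h => (mem_sdiff.mp h).2 hjS), hj]
      ring
    · have hjS : j ∉ S := fun h => hj (mem_filter.mp h).2
      rw [if_pos (mem_sdiff.mpr ⟨mem_univ j, hjS⟩), (hb j).resolve_right hj]
      ring
  have hz' : z = fam a (univ \ S) ((8 - (S.card : ℝ)) / 9) := by
    rw [fam_eq_sum]
    conv_lhs => rw [hrepr]
    exact Finset.sum_congr rfl fun j _ => by rw [hcoef j]
  rcases hs with hs | hs
  · -- `|T| = 5`, coefficient `2/3`
    have hT : (univ \ S).card = 5 := by rw [Finset.card_univ_sdiff, Fintype.card_fin, hs]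
    refine ⟨Sum.inr (Sum.inr (Sum.inr ⟨univ \ S, hT⟩)), ?_⟩
    rw [hz', setOf, coefOf, hs]
    norm_num
  · -- `|T| = 2`, coefficient `1/3`
    have hT : (univ \ S).card = 2 := by rw [Finset.card_univ_sdiff, Fintype.card_fin, hs]
    refine ⟨Sum.inr (Sum.inr (Sum.inl ⟨univ \ S, hT⟩)), ?_⟩
    rw [hz', setOf, coefOf, hs]
    norm_num

/-- **The code is the image of the fixed family over the frame.** -/
theorem eq_image : C = univ.image fun x : Idx => fam a (setOf x) (coefOf x) := by
  classical
  exact eq_image_of_forall_exists C _ (fun z hz => exists_index h1 h2 hN ha hG hz) (by rw [card_Idx, hN])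

end profile

/-! ### Uniqueness -/

/-- **Uniqueness of the `(7, 56, 1/3)` code.** Any two `56`-point codes in `ℝ⁷` with pairwise inner products
`≤ 1/3` are isometric. [cite: ConwaySloane1999, Ch. 14 Thm. 11] -/
theorem isometric {C C' : Finset (EuclideanSpace ℝ (Fin 7))} (h1 : ∀ x ∈ C, ‖x‖ = 1)
    (h2 : ∀ x ∈ C, ∀ y ∈ C, x ≠ y → inner ℝ x y ≤ 1 / 3) (hN : C.card = 56) (h1' : ∀ x ∈ C', ‖x‖ = 1)
    (h2' : ∀ x ∈ C', ∀ y ∈ C', x ≠ y → inner ℝ x y ≤ 1 / 3) (hN' : C'.card = 56) :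
    ∃ Ψ : EuclideanSpace ℝ (Fin 7) ≃ₗᵢ[ℝ] EuclideanSpace ℝ (Fin 7), C' = C.image Ψ := by
  classical
  obtain ⟨a, ha, hG⟩ := exists_frame h1 h2 hN
  obtain ⟨a', ha', hG'⟩ := exists_frame h1' h2' hN'
  exact isometric_of_frames setOf coefOf hG hG' (eq_image h1 h2 hN ha hG) (eq_image h1' h2' hN' ha' hG')

/-- **Ground-state form**: a `56`-point configuration on `S⁶` attaining the universal lower bound of the
`(1+t)^k`-energy for one `k ≥ 6` is isometric to every `(7, 56, 1/3)` code — the `E₇` configuration is the unique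
ground state (Cohn–Kumar Thm 1.2, uniqueness for the row `(7, 56)`). [cite: CohnKumar2006, Theorem 1.2 and Appendix A] -/
theorem isometric_of_ckPow_energy_eq {C C' : Finset (EuclideanSpace ℝ (Fin 7))} (h1 : ∀ x ∈ C, ‖x‖ = 1)
    (hN : C.card = 56) (k : ℕ) (hk : 6 ≤ k)
    (hE : ∑ x ∈ C, ∑ y ∈ C.erase x, (1 + inner ℝ x y) ^ k =
      (56 : ℝ) * ((1 + (-1 : ℝ)) ^ k + 27 * (1 + (-1 / 3 : ℝ)) ^ k + 27 * (1 + (1 / 3 : ℝ)) ^ k))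
    (h1' : ∀ x ∈ C', ‖x‖ = 1) (h2' : ∀ x ∈ C', ∀ y ∈ C', x ≠ y → inner ℝ x y ≤ 1 / 3) (hN' : C'.card = 56) :
    ∃ Ψ : EuclideanSpace ℝ (Fin 7) ≃ₗᵢ[ℝ] EuclideanSpace ℝ (Fin 7), C = C'.image Ψ :=
  isometric h1' h2' hN' h1 (Dim7Card56EnergyRigidity.inner_le_of_ckPow_energy_eq h1 hN k hk hE) hN

end Summit.Ventures.PackingBounds.Config.Dim7Card56Unique

end
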